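import Summits.BirchSwinnertonDyer.Rank1Residual.Additive.XGordRankZeroOneCyclotomicThreeLowerSemistable
import Summits.BirchSwinnertonDyer.Rank1Residual.Additive.XGordRankZeroOneCyclotomicThreeLowerFacts
import HarnessLib

/-!
# The LOWER twin of line V17 (X4, `p = 3`, ranks `(0,1)`, over `K = ℚ(ζ₃)`) from named facts + (⊇/K),
# with Milne's A73 PROVED AWAY on S₁ = `Squarefree N_V`: `Typed.MissingLowerBoundAt W 3` on the
# (G-ord, `e = 2`)@3 rows with `surj(3) ∧ ram(3)`, `r_an(W) = 0`, twist of analytic rank ONE whose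
# conductor is squarefree — anomalous rows included
# (cell `b2b-bsdres`, team n1011, seat p16 GEN 9; Facts-level consumer of
# `XGordRankZeroOneCyclotomicThreeLowerSemistable`, rows T-N11-GK3LOW × T-MIL-CAN)

HONEST FRAMING (cell `b2b-bsdres`, run/shared/lean/b2b/bsd-rank1-residual/, verbatim in every
file): the goal of the cell is to DELETE the COMBINATION-SHAPED residual classes of the
Birch–Swinnerton-Dyer formula for ALL analytic-rank `≤ 1` elliptic curves over `ℚ` — "full BSD
formula for every rank `≤ 1` curve in class `C`" assembled STRICTLY from published theorems — so
that the rank-`≤ 1` remainder becomes exactly the CONSTRUCTION-SHAPED classes, which are TYPED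
(missing-input `Prop`s), NOT attempted. This is not "finishing BSD". Team n1011 (N10 / N11), seat
p16: research route; the labels of X4 / X10 and the N10 / N11 marks are UNCHANGED by this file;
nothing is booked here (the referee rules on bookings).

Theorems only (no `def`, no `sorry`, no new named fact). This is the LOWER-ONLY part of
`XGordRankZeroOneCyclotomicThreeLowerFacts.lean` (p16 gen 2) with the Milne binder `hMilne`
(A73 `Milne1972.bsdQuotient_baseChange_quadratic_anyModel`) REPLACED by the per-row numeral
`hN : Squarefree N_V` (resp. `Squarefree N_{E^{(−3)}}` in the class form): on that population S₁ the two
things the core reads from A73 — `Ш(V_K)` finite and the `3`-adic card identity — are THEOREMS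
(`QuadraticBaseChangeCardIdentityCanonicalModel`, row T-MIL-CAN), consumed through the core twin
`XGordRankZeroOneCyclotomicThreeLower.exists_padicVal_shaAn_add_le_of_semistable` (p306279) and the
population lemma `population_of_squarefree_conductorNorm` (`N_V` squarefree ⟹ `V` good or multiplicative
at every place). Every other binder is VERBATIM the gen-2 Facts file's: Kato Thm. 17.4 (3) over `K`
(`hKato`, torsion clause), Greenberg p. 110 / Schneider (`hS1`), Perrin-Riou (`hPR`), Mazur–Tate (`hMT`),
modularity (`hmod`, `hmodD`), GZK (`hGZK`), the certificate `hcert`, and THE ONE RESIDUAL INPUT (⊇/K) =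
`hLowK` (two-branch main-conjecture containment for `V` over `ℚ(√−3)`; NOT in print; no `def`, no fact).
The two-sided statements of the gen-2 file (`…add_eq…`, `…bsdp_iff…`, `…bsdp_of…`) are NOT twinned
here: their UPPER half (line V17, seat additive-p4) still binds `hMilne`, and replacing it there is
additive-p4's call.

## Results (`V` good ordinary at `3`, `r_an(V) = 1`, `N_V` squarefree; `W = C • V^{(−3)}` additive at
`3`, `r_an(W) = 0`, `surj(3) ∧ ram(3)`)

* `XGordRankZeroOneCyclotomicThreeLower.exists_padicVal_shaAn_add_le_of_surj_of_ram_of_squarefree` —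
  **`ord₃ #Ш_an(V) + ord₃ #Ш_an(W) ≤ ord₃ #Ш(V) + ord₃ #Ш(W)`** from (⊇/K) + named facts + `hcert`, NO Milne;
* `…missingLowerBoundAt_of_missingUpperBoundAt_twist_of_surj_of_ram_of_squarefree` —
  `Typed.MissingLowerBoundAt W 3` ⟸ (⊇/K) + the UPPER half of the rank-one twist `V`;
* `…missingLowerBoundAt_twist_of_missingUpperBoundAt_of_surj_of_ram_of_squarefree` — symmetrically for `V`;
* class form `ClassX4Gord.missingLowerBoundAt_three_rankZero_twistRankOne_of_lowerK_of_surj_of_ram_of_squarefree`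
  on N11's (G-ord)@3 rows with the W-side numeral `Squarefree N_{E^{(−3)}}` (the conductor is a
  `ℚ`-isomorphism invariant, `conductorNorm_smul_rat`; every good-ordinary twist model `V` of `E^{(−3)}`
  has `N_V = N_{E^{(−3)}}`, `exists_variableChange_quadraticTwist_symm`).

Population (EVIDENCE, seat census `HOME/b2b-bsdres-n1011-p16/g8/CENSUS-S1.md`, not re-derived here):
S₁ meets 722 of the 2 115 rank-`(1,0)` X4(G-ord)@3 twist pairs of record. Nothing booked; labels unchanged.
-/

noncomputable section

open scoped Classical MatrixGroups ModularForm

open CongruenceSubgroup WeierstrassCurve NumberField IsDedekindDomain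
  Literature.NumberTheory.EllipticCurves Literature.NumberTheory.EllipticCurves.ModularForms
  Literature.NumberTheory.EllipticCurves.Rank1Residual
  Literature.NumberTheory.EllipticCurves.Rank1Residual.Typed
  Literature.NumberTheory.GaloisRepresentations

namespace Summit.BirchSwinnertonDyer.Rank1Residual.Additive

section Facts

variable (V : WeierstrassCurve ℚ) [V.IsElliptic] [V.IsGloballyMinimal]
  (W : WeierstrassCurve ℚ) [W.IsElliptic] [W.IsGloballyMinimal]

/- The ONE residual input (⊇/K) for `V` over `K = CyclotomicField 3 ℚ` (module docstring); a section
hypothesis shared by every theorem of this section — byte-identical to the gen-2 Facts file's. -/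
variable
    (hLowK : ∀ {κ : ZpExtension (CyclotomicField 3 ℚ) 3}
      {γ : Field.absoluteGaloisGroup (CyclotomicField 3 ℚ)} {N : ℕ} [NeZero N]
      {f : CuspForm (Gamma0 N) 2},
      κ.IsCyclotomic → κ.IsTopGenerator γ →
      (∃ ζ : ℤ_[3]ˣ, IsOfFinOrder ζ ∧
        ((GaloisRep.cyclotomicCharacter (CyclotomicField 3 ℚ) 3 γ * ζ : ℤ_[3]ˣ) : ℤ_[3]) =
          (cyclotomicGenerator 3 : ℤ_[3])) →
      IsNewformOf V f →
      ∀ (D : (V.baseChange (CyclotomicField 3 ℚ)).SelmerDualData κ γ) (ϖ ϖ' : ℚ),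
        (ϖ : ℝ) * V.realPeriodRat = plusPeriod f →
        (ϖ' : ℝ) * V.imaginaryPeriodRat = minusPeriod f →
        ∀ g ∈ D.charIdeal, ∃ h : IwasawaAlgebra 3,
          iwasawaToPowerSeries 3 g =
            iwasawaToPowerSeries 3 h *
              (PowerSeries.C ((ϖ : ℚ_[3]) * (ϖ' : ℚ_[3])) *
                (padicLFunction f ((unitRoot V 3 : ℤ_[3]) : ℚ_[3]) *
                  padicLFunctionMinusBranch f ((unitRoot V 3 : ℤ_[3]) : ℚ_[3]) 1)))

include hLowK

/-- **LOWER twin of line V17 for X4, from named facts + (⊇/K) + the certificate, NO Milne, on S₁.** For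
`V/ℚ` globally minimal, good ordinary at `3`, of analytic rank `1`, WITH SQUAREFREE CONDUCTOR `N_V`,
`W = C • V^{(−3)}` globally minimal ADDITIVE at `3` of analytic rank `0` with `surj(3) ∧ ram(3)`, and the
certificate `[T¹]L₃(f,α) ≠ 0` for the newform(s) of `V`: `#Ш_an(V) = q_V`, `#Ш_an(W) = q_W` with
**`ord₃ q_V + ord₃ q_W ≤ ord₃ #Ш(V) + ord₃ #Ш(W)`**, granted (⊇/K) (`hLowK`) and the named facts Kato
Thm. 17.4 (3) over `ℚ(ζ₃)` (`hKato`, torsion clause), Greenberg p. 110 / Schneider (`hS1`), Perrin-Riou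
1987 (`hPR`), the Mazur–Tate sigma function (`hMT`), modularity (`hmod`, `hmodD`), GZK (`hGZK`) — Milne's
A73 is NOT a hypothesis: `N_V` squarefree puts the pair on S₁ (`population_of_squarefree_conductorNorm`),
where the core twin `…exists_padicVal_shaAn_add_le_of_semistable` reads `Ш(V_K)` finite and the `3`-adic
card identity from theorems. [cite: GreenbergLNM1716, §4 p. 110] [cite: PerrinRiou1987, §1.4 Cor. 1.8]
[cite: Kato2004Asterisque, Thm. 17.4 (3) (p. 273)] [cite: Silverman1994, IV.10.2] -/
theorem XGordRankZeroOneCyclotomicThreeLower.exists_padicVal_shaAn_add_le_of_surj_of_ram_of_squarefree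
    (hKato : Kato2004.charIdeal_dvd_padicLFunction_cyclotomicThree_of_surjective)
    (hS1 : Greenberg1999.schneider_charCoeff_rankOne_quadraticBaseChange)
    (hPR : perrinRiou_rankOne_leadingTerms_odd) (hMT : mazur_tate_sigma_exists_odd)
    (hGZK : rank_eq_analyticRank_of_analyticRank_le_one) (hmod : hasEntireLFunction_rat)
    (hmodD : nonempty_modularParametrizationData)
    (C : VariableChange ℚ) (hC : C • V.quadraticTwist (-(3 : ℚ)) = W)
    (hord : IsOrdinaryAt V 3) (hsurj : Surj W 3) (hram : Ram W 3) (hadd : Addv W 3)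
    (hrV : V.analyticRank = 1) (hrW : W.analyticRank = 0) (hN : Squarefree (V.conductorNorm ℤ))
    (hcert : ∀ {N : ℕ} [NeZero N] (f : CuspForm (Gamma0 N) 2), IsNewformOf V f →
      PowerSeries.coeff 1 (padicLFunction f ((unitRoot V 3 : ℤ_[3]) : ℚ_[3])) ≠ 0) :
    ∃ qV qW : ℚ, shaAn V = (qV : ℂ) ∧ shaAn W = (qW : ℂ) ∧
      padicValRat 3 qV + padicValRat 3 qW ≤ (padicValNat 3 V.shaOrder : ℤ) + padicValNat 3 W.shaOrder := by
  haveI : IsCyclotomicExtension {3} ℚ (CyclotomicField 3 ℚ) := CyclotomicField.isCyclotomicExtension 3 ℚ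
  set K := CyclotomicField 3 ℚ
  haveI : NeZero (V.conductorNorm ℤ) := ⟨(V.conductorNorm_pos_holds).ne'⟩
  obtain ⟨Dm⟩ := hmodD V
  have hf : IsNewformOf V Dm.f := Dm.isNewformOf
  obtain ⟨ϖ, -, hϖ, -⟩ := Dm.exists_rat_mul_realPeriodRat_eq_plusPeriod
  obtain ⟨ϖ', -, hϖ'⟩ := exists_rat_mul_imaginaryPeriodRat_eq_minusPeriod Dm
  obtain ⟨Dh, hDh⟩ := exists_isCanonical_of_odd hMT V 3 (by norm_num) hord.1 hord.2
  have hC' : C • V.quadraticTwist (((-((3 : ℕ) : ℤ)) : ℤ) : ℚ) = W := by push_cast; exact hC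
  have hsurjV : ∀ n : ℕ, V.HasSurjectiveModNGaloisRep (3 ^ n : ℕ) :=
    forall_surj_pow_of_twist_pStar_of_surj_of_ram 3 V (k := -1) (by norm_num) (Or.inr rfl) C hC' hsurj hram
  haveI : (V.baseChange K).IsElliptic := by rw [baseChange]; infer_instance
  refine XGordRankZeroOneCyclotomicThreeLower.exists_padicVal_shaAn_add_le_of_semistable K V W hPR hGZK
    hmod (population_of_squarefree_conductorNorm K V W hN) C hC hord hadd hrV hrW hf ϖ ϖ' hϖ hϖ' Dh hDh
    (hcert Dm.f hf) (fun κ γ hκ hγ hγ' D ↦ ?_)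
    (fun κ γ hκ hγ hγ' D g hg ↦ hLowK hκ hγ hγ' hf D ϖ ϖ' hϖ hϖ' g hg)
    (XGordRankZeroOneCyclotomicThree.schneiderK_of_fact K V hS1 hord)
  exact (hKato V K (V.baseChange K) hord hsurjV ⟨1, one_smul _ _⟩ hκ hγ hγ' hf D ϖ ϖ' hϖ hϖ').1

/-- **`Typed.MissingLowerBoundAt W 3` for the ADDITIVE rank-`0` curve from (⊇/K) and the UPPER half of its
good ordinary rank-ONE twist of squarefree conductor — NO Milne** (X4 ∧ (G-ord, `e = 2`)@3 ∧ `surj ∧ ram`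
∧ `N_V` squarefree, anomalous rows included). [cite: GreenbergLNM1716, §4 p. 110] [cite: Miller2011LMS, Def. 1.1]
[cite: Silverman1994, IV.10.2] -/
theorem XGordRankZeroOneCyclotomicThreeLower.missingLowerBoundAt_of_missingUpperBoundAt_twist_of_surj_of_ram_of_squarefree
    (hKato : Kato2004.charIdeal_dvd_padicLFunction_cyclotomicThree_of_surjective)
    (hS1 : Greenberg1999.schneider_charCoeff_rankOne_quadraticBaseChange)
    (hPR : perrinRiou_rankOne_leadingTerms_odd) (hMT : mazur_tate_sigma_exists_odd)
    (hGZK : rank_eq_analyticRank_of_analyticRank_le_one) (hmod : hasEntireLFunction_rat)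
    (hmodD : nonempty_modularParametrizationData)
    (C : VariableChange ℚ) (hC : C • V.quadraticTwist (-(3 : ℚ)) = W)
    (hord : IsOrdinaryAt V 3) (hsurj : Surj W 3) (hram : Ram W 3) (hadd : Addv W 3)
    (hrV : V.analyticRank = 1) (hrW : W.analyticRank = 0) (hN : Squarefree (V.conductorNorm ℤ))
    (hcert : ∀ {N : ℕ} [NeZero N] (f : CuspForm (Gamma0 N) 2), IsNewformOf V f →
      PowerSeries.coeff 1 (padicLFunction f ((unitRoot V 3 : ℤ_[3]) : ℚ_[3])) ≠ 0)
    (huV : MissingUpperBoundAt V 3) : MissingLowerBoundAt W 3 := by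
  obtain ⟨qV, qW, hqV, hqW, hge⟩ :=
    XGordRankZeroOneCyclotomicThreeLower.exists_padicVal_shaAn_add_le_of_surj_of_ram_of_squarefree V W hLowK
      hKato hS1 hPR hMT hGZK hmod hmodD C hC hord hsurj hram hadd hrV hrW hN hcert
  obtain ⟨qV', hqV', hu⟩ := huV
  have hqq : qV' = qV := by exact_mod_cast hqV'.symm.trans hqV
  subst hqq
  exact ⟨qW, hqW, by linarith⟩

/-- **Symmetrically: `Typed.MissingLowerBoundAt V 3` for the rank-ONE good ordinary curve `V` of squarefree
conductor from (⊇/K) and the UPPER half of its additive rank-`0` twist `W` — NO Milne.**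
[cite: GreenbergLNM1716, §4 p. 110] [cite: Miller2011LMS, Def. 1.1] [cite: Silverman1994, IV.10.2] -/
theorem XGordRankZeroOneCyclotomicThreeLower.missingLowerBoundAt_twist_of_missingUpperBoundAt_of_surj_of_ram_of_squarefree
    (hKato : Kato2004.charIdeal_dvd_padicLFunction_cyclotomicThree_of_surjective)
    (hS1 : Greenberg1999.schneider_charCoeff_rankOne_quadraticBaseChange)
    (hPR : perrinRiou_rankOne_leadingTerms_odd) (hMT : mazur_tate_sigma_exists_odd)
    (hGZK : rank_eq_analyticRank_of_analyticRank_le_one) (hmod : hasEntireLFunction_rat)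
    (hmodD : nonempty_modularParametrizationData)
    (C : VariableChange ℚ) (hC : C • V.quadraticTwist (-(3 : ℚ)) = W)
    (hord : IsOrdinaryAt V 3) (hsurj : Surj W 3) (hram : Ram W 3) (hadd : Addv W 3)
    (hrV : V.analyticRank = 1) (hrW : W.analyticRank = 0) (hN : Squarefree (V.conductorNorm ℤ))
    (hcert : ∀ {N : ℕ} [NeZero N] (f : CuspForm (Gamma0 N) 2), IsNewformOf V f →
      PowerSeries.coeff 1 (padicLFunction f ((unitRoot V 3 : ℤ_[3]) : ℚ_[3])) ≠ 0)
    (huW : MissingUpperBoundAt W 3) : MissingLowerBoundAt V 3 := by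
  obtain ⟨qV, qW, hqV, hqW, hge⟩ :=
    XGordRankZeroOneCyclotomicThreeLower.exists_padicVal_shaAn_add_le_of_surj_of_ram_of_squarefree V W hLowK
      hKato hS1 hPR hMT hGZK hmod hmodD C hC hord hsurj hram hadd hrV hrW hN hcert
  obtain ⟨qW', hqW', hu⟩ := huW
  have hqq : qW' = qW := by exact_mod_cast hqW'.symm.trans hqW
  subst hqq
  exact ⟨qV, hqV, by linarith⟩

end Facts

/-! ## Class form on N11's (G-ord)@3 rows (`ClassX4Gord W 3`, twist of analytic rank one, `N_{E^{(−3)}}`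
squarefree) -/

section ClassForms

variable {W : WeierstrassCurve ℚ} [W.IsElliptic] [W.IsGloballyMinimal]

omit [W.IsGloballyMinimal] in
/-- The conductor of every twist model is the conductor of the twist: if `C • V^{(−3)} = W` then
`N_V = N_{W^{(−3)}}` (`V ≅ W^{(−3)}` over `ℚ`, `exists_variableChange_quadraticTwist_symm`; the conductor
is a `ℚ`-isomorphism invariant, `conductorNorm_smul_rat`). [cite: Silverman1994, IV.10.2] -/
theorem conductorNorm_eq_conductorNorm_quadraticTwist_of_twist_model (V : WeierstrassCurve ℚ) [V.IsElliptic]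
    (C : VariableChange ℚ) (hC : C • V.quadraticTwist (-(3 : ℚ)) = W) :
    V.conductorNorm ℤ = (W.quadraticTwist (-(3 : ℚ))).conductorNorm ℤ := by
  haveI := W.isElliptic_quadraticTwist (show (-(3 : ℚ)) ≠ 0 by norm_num)
  obtain ⟨C', hC'⟩ := exists_variableChange_quadraticTwist_symm W V (show (-(3 : ℚ)) ≠ 0 by norm_num) ⟨C, hC⟩
  rw [← hC', conductorNorm_smul_rat]

variable
    (hLowK : ∀ (V : WeierstrassCurve ℚ) [V.IsElliptic] [V.IsGloballyMinimal] (C : VariableChange ℚ),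
      GoodOrd V 3 → C • V.quadraticTwist (-(3 : ℚ)) = W →
      ∀ {κ : ZpExtension (CyclotomicField 3 ℚ) 3}
      {γ : Field.absoluteGaloisGroup (CyclotomicField 3 ℚ)} {N : ℕ} [NeZero N]
      {f : CuspForm (Gamma0 N) 2},
      κ.IsCyclotomic → κ.IsTopGenerator γ →
      (∃ ζ : ℤ_[3]ˣ, IsOfFinOrder ζ ∧
        ((GaloisRep.cyclotomicCharacter (CyclotomicField 3 ℚ) 3 γ * ζ : ℤ_[3]ˣ) : ℤ_[3]) =
          (cyclotomicGenerator 3 : ℤ_[3])) →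
      IsNewformOf V f →
      ∀ (D : (V.baseChange (CyclotomicField 3 ℚ)).SelmerDualData κ γ) (ϖ ϖ' : ℚ),
        (ϖ : ℝ) * V.realPeriodRat = plusPeriod f →
        (ϖ' : ℝ) * V.imaginaryPeriodRat = minusPeriod f →
        ∀ g ∈ D.charIdeal, ∃ h : IwasawaAlgebra 3,
          iwasawaToPowerSeries 3 g =
            iwasawaToPowerSeries 3 h *
              (PowerSeries.C ((ϖ : ℚ_[3]) * (ϖ' : ℚ_[3])) *
                (padicLFunction f ((unitRoot V 3 : ℤ_[3]) : ℚ_[3]) *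
                  padicLFunctionMinusBranch f ((unitRoot V 3 : ℤ_[3]) : ℚ_[3]) 1)))

include hLowK

/-- **X4♯(G-ord) at `3` ∧ `surj ∧ ram`, `r_an(E) = 0`, twist of analytic rank ONE with SQUAREFREE
CONDUCTOR `N_{E^{(−3)}}`, EVERY such ROW (anomalous included): the LOWER half `ord₃ #Ш_an(E) ≤ ord₃ #Ш(E)`
⟸ (⊇/K) for the good ordinary twist models of `E^{(−3)}` + their certificates `[T¹]L₃ ≠ 0` + their UPPER
halves — NO Milne** (per-row binders over all globally minimal `V`, `C` with `GoodOrd V 3`,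
`C • V^{(−3)} = E`; a model exists by `ClassX4Gord.exists_goodOrd_pStar_twist_model`, `e = 2` by
`semistabilityIndex_eq_two_of_typeG_three`; `N_V = N_{E^{(−3)}}` by
`conductorNorm_eq_conductorNorm_quadraticTwist_of_twist_model`). [cite: GreenbergLNM1716, §4 p. 110]
[cite: Miller2011LMS, Def. 1.1] [cite: Silverman1994, IV.10.2] -/
theorem ClassX4Gord.missingLowerBoundAt_three_rankZero_twistRankOne_of_lowerK_of_surj_of_ram_of_squarefree
    [Fact (Nat.Prime 3)]
    (hKato : Kato2004.charIdeal_dvd_padicLFunction_cyclotomicThree_of_surjective)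
    (hS1 : Greenberg1999.schneider_charCoeff_rankOne_quadraticBaseChange)
    (hPR : perrinRiou_rankOne_leadingTerms_odd) (hMT : mazur_tate_sigma_exists_odd)
    (hGZK : rank_eq_analyticRank_of_analyticRank_le_one) (hmod : hasEntireLFunction_rat)
    (hmodD : nonempty_modularParametrizationData)
    (hX : ClassX4Gord W 3) (hsurj : Surj W 3) (hram : Ram W 3) (hr : W.analyticRank = 0)
    (hN : Squarefree ((W.quadraticTwist (-(3 : ℚ))).conductorNorm ℤ))
    (hrV : ∀ (V : WeierstrassCurve ℚ) [V.IsElliptic] [V.IsGloballyMinimal] (C : VariableChange ℚ),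
      GoodOrd V 3 → C • V.quadraticTwist (-(3 : ℚ)) = W → V.analyticRank = 1)
    (hcert : ∀ (V : WeierstrassCurve ℚ) [V.IsElliptic] [V.IsGloballyMinimal] (C : VariableChange ℚ),
      GoodOrd V 3 → C • V.quadraticTwist (-(3 : ℚ)) = W →
      ∀ {N : ℕ} [NeZero N] (f : CuspForm (Gamma0 N) 2), IsNewformOf V f →
      PowerSeries.coeff 1 (padicLFunction f ((unitRoot V 3 : ℤ_[3]) : ℚ_[3])) ≠ 0)
    (huV : ∀ (V : WeierstrassCurve ℚ) [V.IsElliptic] [V.IsGloballyMinimal] (C : VariableChange ℚ),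
      GoodOrd V 3 → C • V.quadraticTwist (-(3 : ℚ)) = W → MissingUpperBoundAt V 3) :
    MissingLowerBoundAt W 3 := by
  obtain ⟨V, iV, iVm, C, hgo, hC⟩ := ClassX4Gord.exists_goodOrd_pStar_twist_model W 3 hX
    (semistabilityIndex_eq_two_of_typeG_three W hX.typeGOrd.typeG hX.addv.2)
  have hC' : C • V.quadraticTwist (-(3 : ℚ)) = W := by
    have h3 : ((-1 : ℚ) ^ ((3 : ℕ) / 2) * (3 : ℕ)) = -(3 : ℚ) := by norm_num
    rw [← h3]; exact hC
  have hNV : Squarefree (V.conductorNorm ℤ) := by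
    rw [conductorNorm_eq_conductorNorm_quadraticTwist_of_twist_model V C hC']; exact hN
  exact XGordRankZeroOneCyclotomicThreeLower.missingLowerBoundAt_of_missingUpperBoundAt_twist_of_surj_of_ram_of_squarefree
    V W (fun hκ hγ hγ' hf D ϖ ϖ' hϖ hϖ' g hg ↦ hLowK V C hgo hC' hκ hγ hγ' hf D ϖ ϖ' hϖ hϖ' g hg)
    hKato hS1 hPR hMT hGZK hmod hmodD C hC' hgo hsurj hram hX.addv.2 (hrV V C hgo hC') hr hNV
    (hcert V C hgo hC') (huV V C hgo hC')

end ClassForms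

end Summit.BirchSwinnertonDyer.Rank1Residual.Additive

end
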